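import Summits.BirchSwinnertonDyer.BirchSwinnertonDyer.Theorems.ResidualThetaTransportAtTwoThetaLayerLambdaCongruenceAtTwoPlusManin
import Summits.BirchSwinnertonDyer.BirchSwinnertonDyer.Theorems.ResidualThetaTransportAtTwoThetaLayerLambdaCongruenceAtTwoDepletedHecke
import Summits.BirchSwinnertonDyer.BirchSwinnertonDyer.Theorems.ResidualThetaTransportAtTwoThetaLayerLambdaCongruenceAtTwoSymbolOneLayer
import Summits.BirchSwinnertonDyer.BirchSwinnertonDyer.Theorems.ResidualThetaTransportAtTwoThetaLayerLambdaCongruenceAtTwoCurveEulerHecke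
import Summits.BirchSwinnertonDyer.BirchSwinnertonDyer.Theorems.ResidualThetaTransportAtTwoThetaLayerLambdaCongruenceAtTwoEigencharacterCongruence
import Summits.BirchSwinnertonDyer.BirchSwinnertonDyer.Theorems.ResidualThetaTransportAtTwoThetaLayerLambdaCongruenceAtTwoCurveSymbolPrimitive
import Literature.NumberTheory.EllipticCurves.ModularityVersionApProofs
import HarnessLib

/-!
# Crux `ThetaLayerLambdaCongruenceAtTwo` (stmt-BirchSwinnertonDyer-20688, route ResidualThetaTransportAtTwo), line
# `birth`: the PLUS-LINE stub (C3) — «multiplicity one mod 2 for depleted plus-symbol functions» — and the research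
# stub (H-sym-min) FROM it (lead prover bsd-wall-rtt-p3 g2; `--supports stmt-BirchSwinnertonDyer-20688 --as helper`;
# closes nothing)

HONEST FRAMING. THEOREMS ONLY; the research input (C3) and the curve-side Hecke/primitivity package (W-pkg) are
explicit hypotheses spelled inline; nothing about any curve or form is asserted; BSD is not proved by any of this.

WHAT. (C3) `PlusLine` — the ONE algebraic input of Greenberg–Vatsal (10) / Vatsal (1.10) READ AT `p = 2`, stated on
FUNCTIONS (no new definition): for `W` with good supersingular reduction at `2` and `Δ_W < 0` (so `ρ̄ = W[2]` is
absolutely irreducible, ramified at `2`, and complex conjugation is a TRANSVECTION), an odd level `N'` divisible by the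
primes of `N_W`, and two functions `Φ₁, Φ₂ : ℚ → ℚ̄₂` that are `1`-periodic, even, Γ₀(N')-modular-symbol functions
(Manin's relation, shape of `modularSymbol_gamma0_smul`), integral, PRIMITIVE (a unit value each), and Hecke-eigen
modulo the maximal ideal for the SAME system — `T_q ↦ a_q(W)` for primes `q ∤ N'` (including `q = 2`) and `U_ℓ ↦ 0` for
`ℓ ∣ N'` — there is `a ∈ ℚ̄₂` with `‖a·Φ₁ − Φ₂‖ < 1` pointwise. (= the even `𝔪`-eigenspace of
`Hom(H₁(X₀(N'), cusps; ℤ), k̄)` is a `k̄`-line: Buzzard–Wiese multiplicity one at `2` for `ρ̄` ramified at `2` — in print —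
carried to the `U_ℓ ↦ 0` depleted level (Wiles Thm. 2.1 shape) plus «`c` a transvection ⇒ `dim ker(c − 1) = 1`»;
research, not in print at `2`.)
§1 verifies ALL hypotheses of (C3) except primitivity for `Φ₂ := φ^{S₀}_{g,Ω}` (the partner's depleted plus symbol at a
cohomological period): periodic, even (plus symbol), Manin at level `N_W·M·∏_v ℓ_v²` (`…PlusManin`), integral
(`…SymbolStubs`), `T_q`-eigen mod `𝔪` with eigenvalue `a_q(W)` for `q ∤ N'` (w2's `heckeT_depletedPartnerSymbol` + the
crux's `hcong` + `a₂(g) = 0 = a₂(W)`), `U_ℓ = 0` for `ℓ ∣ N'` (w2's `heckeU_depletedPartnerSymbol_eq_zero`; every prime of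
`N'` is some `ℓ_v`, `v ∈ S₀`, by admissibility and `dvd_conductorNorm_iff`). §2 THE GLUE: (C3) + (W-pkg) ⟹ (H-sym-min)
`stub_depletedSymbolCongruenceTwo` of skeleton v5/v6, where (W-pkg) is the curve-side package «a primitive integral
scaling `c·φ^{S₀}_W` exists and `φ^{S₀}_W` is exactly `T_q`-eigen (`a_q(W)`, `q ∉ ℓ(S₀)`) and `U_ℓ`-killed (`ℓ ∈ ℓ(S₀)`)»
(bounded denominators + `L(W,1) ≠ 0` from `r_an = 0`; curve-side twin of w2's depleted Hecke theorems — assigned). At a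
layer `n`: if no layer-`n` value of `φ^{S₀}_{g,Ω}` is a unit, `a = 0` works; otherwise (C3) applies.

References: [GreenbergVatsal2000] §1 (10), §3; [Vatsal1999] Thm. (1.10), §1.4–1.6; [Wiles1995] Thm. 2.1;
[RibetStein2011] Thm. 3.5; [Wiese2007] Thm. 1.1; [Buzzard2000].
-/

noncomputable section

-- justification: the `Summit.BirchSwinnertonDyer.BirchSwinnertonDyer.…` path repeats a component (route-file convention)
set_option linter.dupNamespace false

open scoped Classical MatrixGroups

open Polynomial CongruenceSubgroup Literature.NumberTheory.EllipticCurves Literature.NumberTheory.EllipticCurves.ModularForms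

namespace Summit.BirchSwinnertonDyer.BirchSwinnertonDyer.Theorems.ThetaLayerLambdaCongruenceAtTwo

/-! ## §1. The partner's depleted plus symbol satisfies the hypotheses of the plus-line stub -/

section Partner

/-- `φ^{S₀}_{g,Ω}` is `1`-periodic. [cite: Manin1972, §1.2] -/
theorem depletedPartnerSymbol_add_intCast {M : ℕ} [NeZero M] (g : CuspForm (CongruenceSubgroup.Gamma0 M) 2) (ι : coeffField g →+* PadicAlgCl 2) (Ω : ℂ)
    (S₀ : Finset (IsDedekindDomain.HeightOneSpectrum (NumberField.RingOfIntegers ℚ))) (r : ℚ) (z : ℤ) :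
    (fun x ↦ ∑ k ∈ Fintype.piFinset (fun _ : S₀ ↦ Finset.range 3), (∏ v : S₀, (1 - Polynomial.C (embCoeff g ι (Rat.HeightOneSpectrum.natGenerator (v : IsDedekindDomain.HeightOneSpectrum (NumberField.RingOfIntegers ℚ)))) * Polynomial.X + (if Rat.HeightOneSpectrum.natGenerator (v : IsDedekindDomain.HeightOneSpectrum (NumberField.RingOfIntegers ℚ)) ∣ M then 0 else Polynomial.C (Rat.HeightOneSpectrum.natGenerator (v : IsDedekindDomain.HeightOneSpectrum (NumberField.RingOfIntegers ℚ)) : PadicAlgCl 2)) * Polynomial.X ^ 2 : Polynomial (PadicAlgCl 2)).coeff (k v) * ((Rat.HeightOneSpectrum.natGenerator (v : IsDedekindDomain.HeightOneSpectrum (NumberField.RingOfIntegers ℚ)) : PadicAlgCl 2)⁻¹) ^ (k v)) * ι (plusSymbolK g Ω (x * ((∏ v : S₀, Rat.HeightOneSpectrum.natGenerator (v : IsDedekindDomain.HeightOneSpectrum (NumberField.RingOfIntegers ℚ)) ^ (k v) : ℕ) : ℚ)))) (r + z) = (fun x ↦ ∑ k ∈ Fintype.piFinset (fun _ : S₀ ↦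 Finset.range 3), (∏ v : S₀, (1 - Polynomial.C (embCoeff g ι (Rat.HeightOneSpectrum.natGenerator (v : IsDedekindDomain.HeightOneSpectrum (NumberField.RingOfIntegers ℚ)))) * Polynomial.X + (if Rat.HeightOneSpectrum.natGenerator (v : IsDedekindDomain.HeightOneSpectrum (NumberField.RingOfIntegers ℚ)) ∣ M then 0 else Polynomial.C (Rat.HeightOneSpectrum.natGenerator (v : IsDedekindDomain.HeightOneSpectrum (NumberField.RingOfIntegers ℚ)) : PadicAlgCl 2)) * Polynomial.X ^ 2 : Polynomial (PadicAlgCl 2)).coeff (k v) * ((Rat.HeightOneSpectrum.natGenerator (v : IsDedekindDomain.HeightOneSpectrum (NumberField.RingOfIntegers ℚ)) : PadicAlgCl 2)⁻¹) ^ (k v)) * ι (plusSymbolK g Ω (x * ((∏ v : S₀, Rat.HeightOneSpectrum.natGenerator (v : IsDedekindDomain.HeightOneSpectrum (NumberField.RingOfIntegers ℚ)) ^ (k v) : ℕ) : ℚ)))) r := by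
  simp only
  refine Finset.sum_congr rfl fun k _ ↦ ?_
  have e : (r + (z : ℚ)) * ((∏ v : S₀, Rat.HeightOneSpectrum.natGenerator (v : IsDedekindDomain.HeightOneSpectrum (NumberField.RingOfIntegers ℚ)) ^ (k v) : ℕ) : ℚ) =
      r * ((∏ v : S₀, Rat.HeightOneSpectrum.natGenerator (v : IsDedekindDomain.HeightOneSpectrum (NumberField.RingOfIntegers ℚ)) ^ (k v) : ℕ) : ℚ) +
        ((z * (∏ v : S₀, Rat.HeightOneSpectrum.natGenerator (v : IsDedekindDomain.HeightOneSpectrum (NumberField.RingOfIntegers ℚ)) ^ (k v) : ℕ) : ℤ) : ℚ) := by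
    push_cast; ring
  rw [e, plusSymbolK_add_intCast]

/-- `φ^{S₀}_{g,Ω}` is even. [cite: MazurTateTeitelbaum1986Invent, §I.8] -/
theorem depletedPartnerSymbol_neg {M : ℕ} [NeZero M] (g : CuspForm (CongruenceSubgroup.Gamma0 M) 2) (ι : coeffField g →+* PadicAlgCl 2) (Ω : ℂ)
    (S₀ : Finset (IsDedekindDomain.HeightOneSpectrum (NumberField.RingOfIntegers ℚ))) (r : ℚ) :
    (fun x ↦ ∑ k ∈ Fintype.piFinset (fun _ : S₀ ↦ Finset.range 3), (∏ v : S₀, (1 - Polynomial.C (embCoeff g ι (Rat.HeightOneSpectrum.natGenerator (v : IsDedekindDomain.HeightOneSpectrum (NumberField.RingOfIntegers ℚ)))) * Polynomial.X + (if Rat.HeightOneSpectrum.natGenerator (v : IsDedekindDomain.HeightOneSpectrum (NumberField.RingOfIntegers ℚ)) ∣ M then 0 else Polynomial.C (Rat.HeightOneSpectrum.natGenerator (v : IsDedekindDomain.HeightOneSpectrum (NumberField.RingOfIntegers ℚ)) : PadicAlgCl 2)) * Polynomial.X ^ 2 : Polynomial (PadicAlgCl 2)).coeff (k v) * ((Rat.HeightOneSpectrum.natGenerator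 (v : IsDedekindDomain.HeightOneSpectrum (NumberField.RingOfIntegers ℚ)) : PadicAlgCl 2)⁻¹) ^ (k v)) * ι (plusSymbolK g Ω (x * ((∏ v : S₀, Rat.HeightOneSpectrum.natGenerator (v : IsDedekindDomain.HeightOneSpectrum (NumberField.RingOfIntegers ℚ)) ^ (k v) : ℕ) : ℚ)))) (-r) = (fun x ↦ ∑ k ∈ Fintype.piFinset (fun _ : S₀ ↦ Finset.range 3), (∏ v : S₀, (1 - Polynomial.C (embCoeff g ι (Rat.HeightOneSpectrum.natGenerator (v : IsDedekindDomain.HeightOneSpectrum (NumberField.RingOfIntegers ℚ)))) * Polynomial.X + (if Rat.HeightOneSpectrum.natGenerator (v : IsDedekindDomain.HeightOneSpectrum (NumberField.RingOfIntegers ℚ)) ∣ M then 0 else Polynomial.C (Rat.HeightOneSpectrum.natGenerator (v : IsDedekindDomain.HeightOneSpectrum (NumberField.RingOfIntegers ℚ)) : PadicAlgCl 2)) * Polynomial.X ^ 2 : Polynomial (PadicAlgCl 2)).coeff (k v) * ((Rat.HeightOneSpectrum.natGenerator (v : IsDedekindDomain.HeightOneSpectrum (NumberField.RingOfIntegers ℚ))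 : PadicAlgCl 2)⁻¹) ^ (k v)) * ι (plusSymbolK g Ω (x * ((∏ v : S₀, Rat.HeightOneSpectrum.natGenerator (v : IsDedekindDomain.HeightOneSpectrum (NumberField.RingOfIntegers ℚ)) ^ (k v) : ℕ) : ℚ)))) r := by
  simp only
  refine Finset.sum_congr rfl fun k _ ↦ ?_
  rw [neg_mul, plusSymbolK_neg]

/-- `φ^{S₀}_{g,Ω}` is a Γ₀(N')-symbol function for every `N'` divisible by `M·∏_v ℓ_v²`. [cite: Manin1972, Thm. 1.9] -/
theorem depletedPartnerSymbol_gamma0_smul_of_dvd {M : ℕ} [NeZero M] (g : CuspForm (CongruenceSubgroup.Gamma0 M) 2) (ι : coeffField g →+* PadicAlgCl 2) (Ω : ℂ)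
    (S₀ : Finset (IsDedekindDomain.HeightOneSpectrum (NumberField.RingOfIntegers ℚ))) (hΩ : IsPlusPeriod g Ω)
    {N' : ℕ} (hN' : M * (∏ v : S₀, Rat.HeightOneSpectrum.natGenerator (v : IsDedekindDomain.HeightOneSpectrum (NumberField.RingOfIntegers ℚ)) ^ 2) ∣ N') :
    (∀ (γ : CongruenceSubgroup.Gamma0 (N')) (r : ℚ), ((γ : SL(2, ℤ)) 1 0 : ℚ) * r + ((γ : SL(2, ℤ)) 1 1 : ℚ) ≠ 0 → (fun x ↦ ∑ k ∈ Fintype.piFinset (fun _ : S₀ ↦ Finset.range 3), (∏ v : S₀, (1 - Polynomial.C (embCoeff g ι (Rat.HeightOneSpectrum.natGenerator (v : IsDedekindDomain.HeightOneSpectrum (NumberField.RingOfIntegers ℚ)))) * Polynomial.X + (if Rat.HeightOneSpectrum.natGenerator (v : IsDedekindDomain.HeightOneSpectrum (NumberField.RingOfIntegers ℚ)) ∣ M then 0 else Polynomial.C (Rat.HeightOneSpectrum.natGenerator (v : IsDedekindDomain.HeightOneSpectrum (NumberField.RingOfIntegers ℚ)) : PadicAlgCl 2)) * Polynomial.X ^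 2 : Polynomial (PadicAlgCl 2)).coeff (k v) * ((Rat.HeightOneSpectrum.natGenerator (v : IsDedekindDomain.HeightOneSpectrum (NumberField.RingOfIntegers ℚ)) : PadicAlgCl 2)⁻¹) ^ (k v)) * ι (plusSymbolK g Ω (x * ((∏ v : S₀, Rat.HeightOneSpectrum.natGenerator (v : IsDedekindDomain.HeightOneSpectrum (NumberField.RingOfIntegers ℚ)) ^ (k v) : ℕ) : ℚ)))) ((((γ : SL(2, ℤ)) 0 0 : ℚ) * r + ((γ : SL(2, ℤ)) 0 1 : ℚ)) / (((γ : SL(2, ℤ)) 1 0 : ℚ) * r + ((γ : SL(2, ℤ)) 1 1 : ℚ))) = (if ((γ : SL(2, ℤ)) 1 0) = 0 then 0 else (fun x ↦ ∑ k ∈ Fintype.piFinset (fun _ : S₀ ↦ Finset.range 3), (∏ v : S₀, (1 - Polynomial.C (embCoeff g ι (Rat.HeightOneSpectrum.natGenerator (v : IsDedekindDomain.HeightOneSpectrum (NumberField.RingOfIntegers ℚ)))) * Polynomial.X + (if Rat.HeightOneSpectrum.natGenerator (v : IsDedekindDomain.HeightOneSpectrum (NumberField.RingOfIntegers ℚ))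 ∣ M then 0 else Polynomial.C (Rat.HeightOneSpectrum.natGenerator (v : IsDedekindDomain.HeightOneSpectrum (NumberField.RingOfIntegers ℚ)) : PadicAlgCl 2)) * Polynomial.X ^ 2 : Polynomial (PadicAlgCl 2)).coeff (k v) * ((Rat.HeightOneSpectrum.natGenerator (v : IsDedekindDomain.HeightOneSpectrum (NumberField.RingOfIntegers ℚ)) : PadicAlgCl 2)⁻¹) ^ (k v)) * ι (plusSymbolK g Ω (x * ((∏ v : S₀, Rat.HeightOneSpectrum.natGenerator (v : IsDedekindDomain.HeightOneSpectrum (NumberField.RingOfIntegers ℚ)) ^ (k v) : ℕ) : ℚ)))) ((((γ : SL(2, ℤ)) 0 0 : ℚ)) / (((γ : SL(2, ℤ)) 1 0 : ℚ)))) + (fun x ↦ ∑ k ∈ Fintype.piFinset (fun _ : S₀ ↦ Finset.range 3), (∏ v : S₀, (1 - Polynomial.C (embCoeff g ι (Rat.HeightOneSpectrum.natGenerator (v : IsDedekindDomain.HeightOneSpectrum (NumberField.RingOfIntegers ℚ)))) * Polynomial.X + (if Rat.HeightOneSpectrum.natGenerator (v : IsDedekindDomain.HeightOneSpectrum (NumberField.RingOfIntegers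 ℚ)) ∣ M then 0 else Polynomial.C (Rat.HeightOneSpectrum.natGenerator (v : IsDedekindDomain.HeightOneSpectrum (NumberField.RingOfIntegers ℚ)) : PadicAlgCl 2)) * Polynomial.X ^ 2 : Polynomial (PadicAlgCl 2)).coeff (k v) * ((Rat.HeightOneSpectrum.natGenerator (v : IsDedekindDomain.HeightOneSpectrum (NumberField.RingOfIntegers ℚ)) : PadicAlgCl 2)⁻¹) ^ (k v)) * ι (plusSymbolK g Ω (x * ((∏ v : S₀, Rat.HeightOneSpectrum.natGenerator (v : IsDedekindDomain.HeightOneSpectrum (NumberField.RingOfIntegers ℚ)) ^ (k v) : ℕ) : ℚ)))) r) :=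
  gamma0_smul_of_dvd hN' (fun x ↦ ∑ k ∈ Fintype.piFinset (fun _ : S₀ ↦ Finset.range 3), (∏ v : S₀, (1 - Polynomial.C (embCoeff g ι (Rat.HeightOneSpectrum.natGenerator (v : IsDedekindDomain.HeightOneSpectrum (NumberField.RingOfIntegers ℚ)))) * Polynomial.X + (if Rat.HeightOneSpectrum.natGenerator (v : IsDedekindDomain.HeightOneSpectrum (NumberField.RingOfIntegers ℚ)) ∣ M then 0 else Polynomial.C (Rat.HeightOneSpectrum.natGenerator (v : IsDedekindDomain.HeightOneSpectrum (NumberField.RingOfIntegers ℚ)) : PadicAlgCl 2)) * Polynomial.X ^ 2 : Polynomial (PadicAlgCl 2)).coeff (k v) * ((Rat.HeightOneSpectrum.natGenerator (v : IsDedekindDomain.HeightOneSpectrum (NumberField.RingOfIntegers ℚ)) : PadicAlgCl 2)⁻¹) ^ (k v)) * ι (plusSymbolK g Ω (x * ((∏ v : S₀, Rat.HeightOneSpectrum.natGenerator (v : IsDedekindDomain.HeightOneSpectrum (NumberField.RingOfIntegers ℚ)) ^ (k v) : ℕ) : ℚ))))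
    (depletedPartnerSymbol_gamma0_smul g ι hΩ S₀)

/-- `φ^{S₀}_{g,Ω}` is integral at a cohomological period (every argument). [cite: PollackWeston2011MT, Def. 2.1] -/
theorem norm_depletedPartnerSymbol_le_one' {M : ℕ} [NeZero M] (g : CuspForm (CongruenceSubgroup.Gamma0 M) 2) (ι : coeffField g →+* PadicAlgCl 2) (Ω : ℂ)
    (S₀ : Finset (IsDedekindDomain.HeightOneSpectrum (NumberField.RingOfIntegers ℚ))) (hg : IsNewform0 g) (hΩ : IsCohomologicalPlusPeriod g ι Ω)
    (hS2 : ∀ v ∈ S₀, ((2 : ℕ) : NumberField.RingOfIntegers ℚ) ∉ v.asIdeal) (r : ℚ) :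
    ‖(∑ k ∈ Fintype.piFinset (fun _ : S₀ ↦ Finset.range 3), (∏ v : S₀, (1 - Polynomial.C (embCoeff g ι (Rat.HeightOneSpectrum.natGenerator (v : IsDedekindDomain.HeightOneSpectrum (NumberField.RingOfIntegers ℚ)))) * Polynomial.X + (if Rat.HeightOneSpectrum.natGenerator (v : IsDedekindDomain.HeightOneSpectrum (NumberField.RingOfIntegers ℚ)) ∣ M then 0 else Polynomial.C (Rat.HeightOneSpectrum.natGenerator (v : IsDedekindDomain.HeightOneSpectrum (NumberField.RingOfIntegers ℚ)) : PadicAlgCl 2)) * Polynomial.X ^ 2 : Polynomial (PadicAlgCl 2)).coeff (k v) * ((Rat.HeightOneSpectrum.natGenerator (v : IsDedekindDomain.HeightOneSpectrum (NumberField.RingOfIntegers ℚ)) : PadicAlgCl 2)⁻¹) ^ (k v)) * ι (plusSymbolK g Ω (r * ((∏ v : S₀, Rat.HeightOneSpectrum.natGenerator (v : IsDedekindDomain.HeightOneSpectrum (NumberField.RingOfIntegers ℚ)) ^ (k v) : ℕ) : ℚ))))‖ ≤ 1 := by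
  refine IsUltrametricDist.norm_sum_le_of_forall_le_of_nonneg zero_le_one fun k _ ↦ ?_
  rw [norm_mul, norm_prod]
  refine mul_le_one₀ (Finset.prod_le_one (fun v _ ↦ norm_nonneg _) fun v _ ↦ ?_) (norm_nonneg _)
    (hΩ.norm_le_one _)
  rw [norm_mul, norm_pow, norm_inv, norm_natCast_padicAlgCl_two_eq_one (not_two_dvd_natGenerator (hS2 v v.2)),
    inv_one, one_pow, mul_one]
  exact norm_coeff_partnerEulerPolynomial_le_one hg ι _ _

/-- **`T_q`-eigen modulo the maximal ideal with the CURVE's eigenvalue**: for a prime `q` off `S₀` with `q ∤ M`,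
`‖T_q φ^{S₀}_{g,Ω}(r) − a_q(W)·φ^{S₀}_{g,Ω}(r)‖ < 1`, `a_q(W) = W.LFunction q` — from w2's exact relation
`T_q φ^{S₀} = ι a_q(g)·φ^{S₀}` (p583400) and the eigencharacter congruence `‖ι a_q(g) − a_q(W)‖ < 1` (p584497).
[cite: GreenbergVatsal2000, §3 (the depleted forms share all Hecke eigenvalues mod 𝔪)] -/
theorem depletedPartnerSymbol_heckeT_sub_lt_one {M : ℕ} [NeZero M] (g : CuspForm (CongruenceSubgroup.Gamma0 M) 2) (ι : coeffField g →+* PadicAlgCl 2) (Ω : ℂ)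
    (S₀ : Finset (IsDedekindDomain.HeightOneSpectrum (NumberField.RingOfIntegers ℚ))) (hg : IsNewform0 g)
    (hΩ : IsCohomologicalPlusPeriod g ι Ω) (hS2 : ∀ v ∈ S₀, ((2 : ℕ) : NumberField.RingOfIntegers ℚ) ∉ v.asIdeal)
    (W : WeierstrassCurve ℚ) [W.IsElliptic] [W.IsGloballyMinimal] (ha2 : cuspCoeff g 2 = 0)
    (haW : W.frobeniusTrace 2 = 0)
    (hcong : ∀ ℓ : ℕ, ℓ.Prime → ¬ ℓ ∣ 2 * M * W.conductorNorm ℤ →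
      ‖embCoeff g ι ℓ - (W.frobeniusTrace ℓ : PadicAlgCl 2)‖ < 1)
    (hSW : ∀ v : IsDedekindDomain.HeightOneSpectrum (NumberField.RingOfIntegers ℚ), ¬ W.HasGoodReductionAt v → v ∈ S₀)
    (hSM : ∀ v : IsDedekindDomain.HeightOneSpectrum (NumberField.RingOfIntegers ℚ),
      Rat.HeightOneSpectrum.natGenerator v ∣ M → v ∈ S₀)
    {q : ℕ} (hq : q.Prime) (hqM : ¬ q ∣ M)
    (hqS : ∀ v ∈ S₀, Rat.HeightOneSpectrum.natGenerator v ≠ q) (r : ℚ) :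
    ‖(∑ j : Fin q, (∑ k ∈ Fintype.piFinset (fun _ : S₀ ↦ Finset.range 3), (∏ v : S₀, (1 - Polynomial.C (embCoeff g ι (Rat.HeightOneSpectrum.natGenerator (v : IsDedekindDomain.HeightOneSpectrum (NumberField.RingOfIntegers ℚ)))) * Polynomial.X + (if Rat.HeightOneSpectrum.natGenerator (v : IsDedekindDomain.HeightOneSpectrum (NumberField.RingOfIntegers ℚ)) ∣ M then 0 else Polynomial.C (Rat.HeightOneSpectrum.natGenerator (v : IsDedekindDomain.HeightOneSpectrum (NumberField.RingOfIntegers ℚ)) : PadicAlgCl 2)) * Polynomial.X ^ 2 : Polynomial (PadicAlgCl 2)).coeff (k v) * ((Rat.HeightOneSpectrum.natGenerator (v : IsDedekindDomain.HeightOneSpectrum (NumberField.RingOfIntegers ℚ)) : PadicAlgCl 2)⁻¹) ^ (k v)) * ι (plusSymbolK g Ω (((r + j) / q) * ((∏ v : S₀, Rat.HeightOneSpectrum.natGenerator (v : IsDedekindDomain.HeightOneSpectrum (NumberField.RingOfIntegers ℚ)) ^ (k v) : ℕ) : ℚ))))) + (∑ k ∈ Fintype.piFinset (fun _ : S₀ ↦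 Finset.range 3), (∏ v : S₀, (1 - Polynomial.C (embCoeff g ι (Rat.HeightOneSpectrum.natGenerator (v : IsDedekindDomain.HeightOneSpectrum (NumberField.RingOfIntegers ℚ)))) * Polynomial.X + (if Rat.HeightOneSpectrum.natGenerator (v : IsDedekindDomain.HeightOneSpectrum (NumberField.RingOfIntegers ℚ)) ∣ M then 0 else Polynomial.C (Rat.HeightOneSpectrum.natGenerator (v : IsDedekindDomain.HeightOneSpectrum (NumberField.RingOfIntegers ℚ)) : PadicAlgCl 2)) * Polynomial.X ^ 2 : Polynomial (PadicAlgCl 2)).coeff (k v) * ((Rat.HeightOneSpectrum.natGenerator (v : IsDedekindDomain.HeightOneSpectrum (NumberField.RingOfIntegers ℚ)) : PadicAlgCl 2)⁻¹) ^ (k v)) * ι (plusSymbolK g Ω ((q * r) * ((∏ v : S₀, Rat.HeightOneSpectrum.natGenerator (v : IsDedekindDomain.HeightOneSpectrum (NumberField.RingOfIntegers ℚ)) ^ (k v) : ℕ) : ℚ)))) -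
        (W.LFunction q : PadicAlgCl 2) * (∑ k ∈ Fintype.piFinset (fun _ : S₀ ↦ Finset.range 3), (∏ v : S₀, (1 - Polynomial.C (embCoeff g ι (Rat.HeightOneSpectrum.natGenerator (v : IsDedekindDomain.HeightOneSpectrum (NumberField.RingOfIntegers ℚ)))) * Polynomial.X + (if Rat.HeightOneSpectrum.natGenerator (v : IsDedekindDomain.HeightOneSpectrum (NumberField.RingOfIntegers ℚ)) ∣ M then 0 else Polynomial.C (Rat.HeightOneSpectrum.natGenerator (v : IsDedekindDomain.HeightOneSpectrum (NumberField.RingOfIntegers ℚ)) : PadicAlgCl 2)) * Polynomial.X ^ 2 : Polynomial (PadicAlgCl 2)).coeff (k v) * ((Rat.HeightOneSpectrum.natGenerator (v : IsDedekindDomain.HeightOneSpectrum (NumberField.RingOfIntegers ℚ)) : PadicAlgCl 2)⁻¹) ^ (k v)) * ι (plusSymbolK g Ω (r * ((∏ v : S₀, Rat.HeightOneSpectrum.natGenerator (v : IsDedekindDomain.HeightOneSpectrum (NumberField.RingOfIntegers ℚ)) ^ (k v) : ℕ) : ℚ))))‖ < 1 := by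
  have hT := heckeT_depletedPartnerSymbol ι hg hΩ.isPlusPeriod S₀ hq hqS r
  rw [if_neg hqM, mul_inv_cancel₀ (by exact_mod_cast hq.ne_zero : (q : PadicAlgCl 2) ≠ 0), one_mul] at hT
  rw [← hT, ← sub_mul, norm_mul]
  exact mul_lt_one_of_nonneg_of_lt_one_left (norm_nonneg _)
    (norm_embCoeff_sub_lFunction_lt_one haW ι ha2 hcong S₀ hSW hSM hq hqS)
    (norm_depletedPartnerSymbol_le_one' g ι Ω S₀ hg hΩ hS2 r)

/-- Every prime factor of `N_W·M·∏_{v∈S₀} ℓ_v²` is `ℓ_{v₀}` for some `v₀ ∈ S₀`, when `S₀` contains the bad places of `W`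
and the places over `M` (`ℓ ∣ N_W ⟺` bad reduction, `dvd_conductorNorm_iff`). [cite: DiamondShurman2005, §8.3] -/
theorem exists_mem_natGenerator_eq_of_dvd (W : WeierstrassCurve ℚ) [W.IsElliptic] {M : ℕ}
    (S₀ : Finset (IsDedekindDomain.HeightOneSpectrum (NumberField.RingOfIntegers ℚ)))
    (hSW : ∀ v : IsDedekindDomain.HeightOneSpectrum (NumberField.RingOfIntegers ℚ), ¬ W.HasGoodReductionAt v → v ∈ S₀)
    (hSM : ∀ v : IsDedekindDomain.HeightOneSpectrum (NumberField.RingOfIntegers ℚ),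
      Rat.HeightOneSpectrum.natGenerator v ∣ M → v ∈ S₀)
    {ℓ : ℕ} (hℓ : ℓ.Prime) (hdvd : ℓ ∣ W.conductorNorm ℤ * M * (∏ v : S₀, Rat.HeightOneSpectrum.natGenerator (v : IsDedekindDomain.HeightOneSpectrum (NumberField.RingOfIntegers ℚ)) ^ 2)) :
    ∃ v₀ ∈ S₀, Rat.HeightOneSpectrum.natGenerator v₀ = ℓ := by
  have hgen : Rat.HeightOneSpectrum.natGenerator
      ((Rat.HeightOneSpectrum.primesEquiv (R := NumberField.RingOfIntegers ℚ)).symm ⟨ℓ, hℓ⟩) = ℓ :=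
    congrArg Subtype.val
      ((Rat.HeightOneSpectrum.primesEquiv (R := NumberField.RingOfIntegers ℚ)).apply_symm_apply ⟨ℓ, hℓ⟩)
  rcases (Nat.Prime.dvd_mul hℓ).mp hdvd with h | h
  · rcases (Nat.Prime.dvd_mul hℓ).mp h with h | h
    · refine ⟨_, hSW _ ?_, hgen⟩
      have h' : ((Rat.HeightOneSpectrum.primesEquiv
          ((Rat.HeightOneSpectrum.primesEquiv (R := NumberField.RingOfIntegers ℚ)).symm ⟨ℓ, hℓ⟩) : Nat.Primes) : ℕ) ∣
          W.conductorNorm ℤ := by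
        rw [Equiv.apply_symm_apply]; exact h
      exact (WeierstrassCurve.dvd_conductorNorm_iff W _).mp h'
    · exact ⟨_, hSM _ (by rw [hgen]; exact h), hgen⟩
  · obtain ⟨v, -, hv⟩ := (Prime.dvd_finsetProd_iff hℓ.prime _).mp h
    have hvℓ := (Nat.prime_dvd_prime_iff_eq hℓ (Rat.HeightOneSpectrum.prime_natGenerator _)).mp (hℓ.dvd_of_dvd_pow hv)
    exact ⟨v, v.2, hvℓ.symm⟩

/-- **`U_ℓ φ^{S₀}_{g,Ω} = 0` for every prime `ℓ` of `N_W·M·∏_v ℓ_v²`** (each is some `ℓ_{v₀}`, `v₀ ∈ S₀`; w2's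
`heckeU_depletedPartnerSymbol_eq_zero`). [cite: GreenbergVatsal2000, §3] -/
theorem depletedPartnerSymbol_heckeU_eq_zero {M : ℕ} [NeZero M] (g : CuspForm (CongruenceSubgroup.Gamma0 M) 2) (ι : coeffField g →+* PadicAlgCl 2) (Ω : ℂ)
    (S₀ : Finset (IsDedekindDomain.HeightOneSpectrum (NumberField.RingOfIntegers ℚ))) (hg : IsNewform0 g) (hΩ : IsPlusPeriod g Ω)
    (W : WeierstrassCurve ℚ) [W.IsElliptic]
    (hSW : ∀ v : IsDedekindDomain.HeightOneSpectrum (NumberField.RingOfIntegers ℚ), ¬ W.HasGoodReductionAt v → v ∈ S₀)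
    (hSM : ∀ v : IsDedekindDomain.HeightOneSpectrum (NumberField.RingOfIntegers ℚ),
      Rat.HeightOneSpectrum.natGenerator v ∣ M → v ∈ S₀)
    {ℓ : ℕ} (hℓ : ℓ.Prime) (hdvd : ℓ ∣ W.conductorNorm ℤ * M * (∏ v : S₀, Rat.HeightOneSpectrum.natGenerator (v : IsDedekindDomain.HeightOneSpectrum (NumberField.RingOfIntegers ℚ)) ^ 2)) (r : ℚ) :
    ∑ j : Fin ℓ, (∑ k ∈ Fintype.piFinset (fun _ : S₀ ↦ Finset.range 3), (∏ v : S₀, (1 - Polynomial.C (embCoeff g ι (Rat.HeightOneSpectrum.natGenerator (v : IsDedekindDomain.HeightOneSpectrum (NumberField.RingOfIntegers ℚ)))) * Polynomial.X + (if Rat.HeightOneSpectrum.natGenerator (v : IsDedekindDomain.HeightOneSpectrum (NumberField.RingOfIntegers ℚ)) ∣ M then 0 else Polynomial.C (Rat.HeightOneSpectrum.natGenerator (v : IsDedekindDomain.HeightOneSpectrum (NumberField.RingOfIntegers ℚ)) : PadicAlgCl 2)) * Polynomial.X ^ 2 : Polynomial (PadicAlgCl 2)).coeff (k v) * ((Rat.HeightOneSpectrum.natGenerator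 (v : IsDedekindDomain.HeightOneSpectrum (NumberField.RingOfIntegers ℚ)) : PadicAlgCl 2)⁻¹) ^ (k v)) * ι (plusSymbolK g Ω (((r + j) / ℓ) * ((∏ v : S₀, Rat.HeightOneSpectrum.natGenerator (v : IsDedekindDomain.HeightOneSpectrum (NumberField.RingOfIntegers ℚ)) ^ (k v) : ℕ) : ℚ)))) = 0 := by
  obtain ⟨v₀, hv₀, hgen⟩ := exists_mem_natGenerator_eq_of_dvd W S₀ hSW hSM hℓ hdvd
  subst hgen
  exact heckeU_depletedPartnerSymbol_eq_zero ι hg hΩ S₀ hv₀ r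

/-- A prime NOT dividing the depleted level `N_W·M·∏_v ℓ_v²` divides neither `N_W` nor `M` and is none of the
`ℓ_v`, `v ∈ S₀`. [folklore] -/
theorem off_depletedLevel (W : WeierstrassCurve ℚ) [W.IsElliptic] (M : ℕ)
    (S₀ : Finset (IsDedekindDomain.HeightOneSpectrum (NumberField.RingOfIntegers ℚ))) {q : ℕ}
    (hnd : ¬ q ∣ W.conductorNorm ℤ * M * (∏ v : S₀, Rat.HeightOneSpectrum.natGenerator (v : IsDedekindDomain.HeightOneSpectrum (NumberField.RingOfIntegers ℚ)) ^ 2)) :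
    ¬ q ∣ W.conductorNorm ℤ ∧ ¬ q ∣ M ∧ ∀ v ∈ S₀, Rat.HeightOneSpectrum.natGenerator v ≠ q := by
  refine ⟨fun h ↦ hnd (dvd_mul_of_dvd_left (dvd_mul_of_dvd_left h M) _),
    fun h ↦ hnd (dvd_mul_of_dvd_left (dvd_mul_of_dvd_right h (W.conductorNorm ℤ)) _), fun v hv heq ↦ hnd ?_⟩
  refine dvd_mul_of_dvd_right ?_ _
  have h1 : Rat.HeightOneSpectrum.natGenerator v ∣
      Rat.HeightOneSpectrum.natGenerator ((⟨v, hv⟩ : S₀) : IsDedekindDomain.HeightOneSpectrum (NumberField.RingOfIntegers ℚ)) ^ 2 :=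
    dvd_pow_self _ two_ne_zero
  have h2 := Finset.dvd_prod_of_mem
    (fun w : S₀ ↦ Rat.HeightOneSpectrum.natGenerator (w : IsDedekindDomain.HeightOneSpectrum (NumberField.RingOfIntegers ℚ)) ^ 2)
    (Finset.mem_univ (⟨v, hv⟩ : S₀))
  rw [← heq]
  exact h1.trans h2

/-- The depleted level `N_W·M·∏_v ℓ_v²` is odd on the habitat (`W` good at `2`, `M` odd, `2 ∉ S₀`).
[cite: DiamondShurman2005, §8.3] -/
theorem odd_depletedLevel (W : WeierstrassCurve ℚ) [W.IsElliptic] [W.IsGloballyMinimal]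
    (hss : Literature.NumberTheory.EllipticCurves.Rank1Residual.GoodSS W 2) {M : ℕ} (hM : Odd M)
    (S₀ : Finset (IsDedekindDomain.HeightOneSpectrum (NumberField.RingOfIntegers ℚ)))
    (hS2 : ∀ v ∈ S₀, ((2 : ℕ) : NumberField.RingOfIntegers ℚ) ∉ v.asIdeal) :
    Odd (W.conductorNorm ℤ * M * (∏ v : S₀, Rat.HeightOneSpectrum.natGenerator (v : IsDedekindDomain.HeightOneSpectrum (NumberField.RingOfIntegers ℚ)) ^ 2)) := by
  have hN : ¬ 2 ∣ W.conductorNorm ℤ := by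
    rw [WeierstrassCurve.dvd_conductorNorm_iff_not_hasGoodReductionAtPrime, not_not]
    exact hss.1
  refine Nat.odd_mul.mpr ⟨Nat.odd_mul.mpr ⟨Nat.odd_iff.mpr (Nat.two_dvd_ne_zero.mp hN), hM⟩, ?_⟩
  rw [Nat.odd_iff, ← Nat.two_dvd_ne_zero]
  intro h
  obtain ⟨v, -, hv⟩ := (Prime.dvd_finsetProd_iff Nat.prime_two.prime _).mp h
  exact not_two_dvd_natGenerator (hS2 v v.2) (Nat.prime_two.dvd_of_dvd_pow hv)

end Partner

/-! ## §2. The curve's depleted plus symbol: periodic, even, Manin, exact Hecke relations (w2) -/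

section Curve

variable (W : WeierstrassCurve ℚ) [W.IsElliptic] [W.IsGloballyMinimal] [NeZero (W.conductorNorm ℤ)]
  {f : CuspForm (CongruenceSubgroup.Gamma0 (W.conductorNorm ℤ)) 2}
  (S₀ : Finset (IsDedekindDomain.HeightOneSpectrum (NumberField.RingOfIntegers ℚ)))

omit [W.IsElliptic] [W.IsGloballyMinimal] in
/-- `c·φ^{S₀}_W` is `1`-periodic. [cite: Manin1972, §1.2] -/
theorem depletedCurveSymbol_add_intCast (c : PadicAlgCl 2) (r : ℚ) (z : ℤ) :
    (fun x ↦ c * (fun x ↦ ∑ k ∈ Fintype.piFinset (fun _ : S₀ ↦ Finset.range 3), (∏ v : S₀, ((W.localPolynomialAt (v : IsDedekindDomain.HeightOneSpectrum (NumberField.RingOfIntegers ℚ))).map (Int.castRingHom (PadicAlgCl 2))).coeff (k v) * ((Rat.HeightOneSpectrum.natGenerator (v : IsDedekindDomain.HeightOneSpectrum (NumberField.RingOfIntegers ℚ)) : PadicAlgCl 2)⁻¹) ^ (k v)) * algebraMap ℚ (PadicAlgCl 2) (ratPlusSymbol f (x * ((∏ v : S₀, Rat.HeightOneSpectrum.natGenerator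 (v : IsDedekindDomain.HeightOneSpectrum (NumberField.RingOfIntegers ℚ)) ^ (k v) : ℕ) : ℚ)))) x) (r + z) = (fun x ↦ c * (fun x ↦ ∑ k ∈ Fintype.piFinset (fun _ : S₀ ↦ Finset.range 3), (∏ v : S₀, ((W.localPolynomialAt (v : IsDedekindDomain.HeightOneSpectrum (NumberField.RingOfIntegers ℚ))).map (Int.castRingHom (PadicAlgCl 2))).coeff (k v) * ((Rat.HeightOneSpectrum.natGenerator (v : IsDedekindDomain.HeightOneSpectrum (NumberField.RingOfIntegers ℚ)) : PadicAlgCl 2)⁻¹) ^ (k v)) * algebraMap ℚ (PadicAlgCl 2) (ratPlusSymbol f (x * ((∏ v : S₀, Rat.HeightOneSpectrum.natGenerator (v : IsDedekindDomain.HeightOneSpectrum (NumberField.RingOfIntegers ℚ)) ^ (k v) : ℕ) : ℚ)))) x) r := by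
  simp only
  congr 1
  refine Finset.sum_congr rfl fun k _ ↦ ?_
  have e : (r + (z : ℚ)) * ((∏ v : S₀, Rat.HeightOneSpectrum.natGenerator (v : IsDedekindDomain.HeightOneSpectrum (NumberField.RingOfIntegers ℚ)) ^ (k v) : ℕ) : ℚ) =
      r * ((∏ v : S₀, Rat.HeightOneSpectrum.natGenerator (v : IsDedekindDomain.HeightOneSpectrum (NumberField.RingOfIntegers ℚ)) ^ (k v) : ℕ) : ℚ) +
        ((z * (∏ v : S₀, Rat.HeightOneSpectrum.natGenerator (v : IsDedekindDomain.HeightOneSpectrum (NumberField.RingOfIntegers ℚ)) ^ (k v) : ℕ) : ℤ) : ℚ) := by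
    push_cast; ring
  rw [e, ratPlusSymbol_add_intCast_eq]

omit [W.IsElliptic] [W.IsGloballyMinimal] [NeZero (W.conductorNorm ℤ)] in
/-- `c·φ^{S₀}_W` is even. [cite: MazurTateTeitelbaum1986Invent, §I.8] -/
theorem depletedCurveSymbol_neg (c : PadicAlgCl 2) (r : ℚ) :
    (fun x ↦ c * (fun x ↦ ∑ k ∈ Fintype.piFinset (fun _ : S₀ ↦ Finset.range 3), (∏ v : S₀, ((W.localPolynomialAt (v : IsDedekindDomain.HeightOneSpectrum (NumberField.RingOfIntegers ℚ))).map (Int.castRingHom (PadicAlgCl 2))).coeff (k v) * ((Rat.HeightOneSpectrum.natGenerator (v : IsDedekindDomain.HeightOneSpectrum (NumberField.RingOfIntegers ℚ)) : PadicAlgCl 2)⁻¹) ^ (k v)) * algebraMap ℚ (PadicAlgCl 2) (ratPlusSymbol f (x * ((∏ v : S₀, Rat.HeightOneSpectrum.natGenerator (v : IsDedekindDomain.HeightOneSpectrum (NumberField.RingOfIntegers ℚ)) ^ (k v) : ℕ) : ℚ)))) x) (-r) = (fun x ↦ c * (fun x ↦ ∑ k ∈ Fintype.piFinset (fun _ :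 S₀ ↦ Finset.range 3), (∏ v : S₀, ((W.localPolynomialAt (v : IsDedekindDomain.HeightOneSpectrum (NumberField.RingOfIntegers ℚ))).map (Int.castRingHom (PadicAlgCl 2))).coeff (k v) * ((Rat.HeightOneSpectrum.natGenerator (v : IsDedekindDomain.HeightOneSpectrum (NumberField.RingOfIntegers ℚ)) : PadicAlgCl 2)⁻¹) ^ (k v)) * algebraMap ℚ (PadicAlgCl 2) (ratPlusSymbol f (x * ((∏ v : S₀, Rat.HeightOneSpectrum.natGenerator (v : IsDedekindDomain.HeightOneSpectrum (NumberField.RingOfIntegers ℚ)) ^ (k v) : ℕ) : ℚ)))) x) r := by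
  simp only
  congr 1
  refine Finset.sum_congr rfl fun k _ ↦ ?_
  rw [neg_mul, ratPlusSymbol_neg]

variable {W S₀}

omit [W.IsElliptic] [W.IsGloballyMinimal] in
/-- `c·φ^{S₀}_W` is a Γ₀(N')-symbol function for every `N'` divisible by `N_W·∏_v ℓ_v²`. [cite: Manin1972, Thm. 1.9] -/
theorem depletedCurveSymbol_gamma0_smul_of_dvd (hf : IsNewformOf W f) (c : PadicAlgCl 2)
    {N' : ℕ} (hN' : W.conductorNorm ℤ * (∏ v : S₀, Rat.HeightOneSpectrum.natGenerator (v : IsDedekindDomain.HeightOneSpectrum (NumberField.RingOfIntegers ℚ)) ^ 2) ∣ N') :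
    (∀ (γ : CongruenceSubgroup.Gamma0 (N')) (r : ℚ), ((γ : SL(2, ℤ)) 1 0 : ℚ) * r + ((γ : SL(2, ℤ)) 1 1 : ℚ) ≠ 0 → (fun x ↦ c * (fun x ↦ ∑ k ∈ Fintype.piFinset (fun _ : S₀ ↦ Finset.range 3), (∏ v : S₀, ((W.localPolynomialAt (v : IsDedekindDomain.HeightOneSpectrum (NumberField.RingOfIntegers ℚ))).map (Int.castRingHom (PadicAlgCl 2))).coeff (k v) * ((Rat.HeightOneSpectrum.natGenerator (v : IsDedekindDomain.HeightOneSpectrum (NumberField.RingOfIntegers ℚ)) : PadicAlgCl 2)⁻¹) ^ (k v)) * algebraMap ℚ (PadicAlgCl 2) (ratPlusSymbol f (x * ((∏ v : S₀, Rat.HeightOneSpectrum.natGenerator (v : IsDedekindDomain.HeightOneSpectrum (NumberField.RingOfIntegers ℚ)) ^ (k v) : ℕ) : ℚ)))) x) ((((γ : SL(2, ℤ)) 0 0 : ℚ) * r + ((γ : SL(2, ℤ)) 0 1 : ℚ)) / (((γ : SL(2, ℤ)) 1 0 : ℚ) * r + ((γ : SL(2, ℤ)) 1 1 : ℚ)))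 = (if ((γ : SL(2, ℤ)) 1 0) = 0 then 0 else (fun x ↦ c * (fun x ↦ ∑ k ∈ Fintype.piFinset (fun _ : S₀ ↦ Finset.range 3), (∏ v : S₀, ((W.localPolynomialAt (v : IsDedekindDomain.HeightOneSpectrum (NumberField.RingOfIntegers ℚ))).map (Int.castRingHom (PadicAlgCl 2))).coeff (k v) * ((Rat.HeightOneSpectrum.natGenerator (v : IsDedekindDomain.HeightOneSpectrum (NumberField.RingOfIntegers ℚ)) : PadicAlgCl 2)⁻¹) ^ (k v)) * algebraMap ℚ (PadicAlgCl 2) (ratPlusSymbol f (x * ((∏ v : S₀, Rat.HeightOneSpectrum.natGenerator (v : IsDedekindDomain.HeightOneSpectrum (NumberField.RingOfIntegers ℚ)) ^ (k v) : ℕ) : ℚ)))) x) ((((γ : SL(2, ℤ)) 0 0 : ℚ)) / (((γ : SL(2, ℤ)) 1 0 : ℚ)))) + (fun x ↦ c * (fun x ↦ ∑ k ∈ Fintype.piFinset (fun _ : S₀ ↦ Finset.range 3), (∏ v : S₀, ((W.localPolynomialAt (v : IsDedekindDomain.HeightOneSpectrum (NumberField.RingOfIntegers ℚ))).map (Int.castRingHom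 (PadicAlgCl 2))).coeff (k v) * ((Rat.HeightOneSpectrum.natGenerator (v : IsDedekindDomain.HeightOneSpectrum (NumberField.RingOfIntegers ℚ)) : PadicAlgCl 2)⁻¹) ^ (k v)) * algebraMap ℚ (PadicAlgCl 2) (ratPlusSymbol f (x * ((∏ v : S₀, Rat.HeightOneSpectrum.natGenerator (v : IsDedekindDomain.HeightOneSpectrum (NumberField.RingOfIntegers ℚ)) ^ (k v) : ℕ) : ℚ)))) x) r) :=
  gamma0_smul_const_mul c (fun x ↦ ∑ k ∈ Fintype.piFinset (fun _ : S₀ ↦ Finset.range 3), (∏ v : S₀, ((W.localPolynomialAt (v : IsDedekindDomain.HeightOneSpectrum (NumberField.RingOfIntegers ℚ))).map (Int.castRingHom (PadicAlgCl 2))).coeff (k v) * ((Rat.HeightOneSpectrum.natGenerator (v : IsDedekindDomain.HeightOneSpectrum (NumberField.RingOfIntegers ℚ)) : PadicAlgCl 2)⁻¹) ^ (k v)) * algebraMap ℚ (PadicAlgCl 2) (ratPlusSymbol f (x * ((∏ v : S₀, Rat.HeightOneSpectrum.natGenerator (v : IsDedekindDomain.HeightOneSpectrum (NumberField.RingOfIntegers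 ℚ)) ^ (k v) : ℕ) : ℚ))))
    (gamma0_smul_of_dvd hN' (fun x ↦ ∑ k ∈ Fintype.piFinset (fun _ : S₀ ↦ Finset.range 3), (∏ v : S₀, ((W.localPolynomialAt (v : IsDedekindDomain.HeightOneSpectrum (NumberField.RingOfIntegers ℚ))).map (Int.castRingHom (PadicAlgCl 2))).coeff (k v) * ((Rat.HeightOneSpectrum.natGenerator (v : IsDedekindDomain.HeightOneSpectrum (NumberField.RingOfIntegers ℚ)) : PadicAlgCl 2)⁻¹) ^ (k v)) * algebraMap ℚ (PadicAlgCl 2) (ratPlusSymbol f (x * ((∏ v : S₀, Rat.HeightOneSpectrum.natGenerator (v : IsDedekindDomain.HeightOneSpectrum (NumberField.RingOfIntegers ℚ)) ^ (k v) : ℕ) : ℚ))))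
    (depletedCurveSymbol_gamma0_smul W hf S₀))

/-- **Exact `T_q`-relation for `c·φ^{S₀}_W`** with eigenvalue `a_q(W) = W.LFunction q`, for primes `q` off `S₀` with
`q ∤ N_W` (w2's `heckeT_depletedCurveSymbol_localPolynomialAt`). [cite: GreenbergVatsal2000, §3] -/
theorem depletedCurveSymbol_heckeT_sub_eq_zero (hf : IsNewformOf W f) (c : PadicAlgCl 2) {q : ℕ} (hq : q.Prime)
    (hqN : ¬ q ∣ W.conductorNorm ℤ) (hqS : ∀ v ∈ S₀, Rat.HeightOneSpectrum.natGenerator v ≠ q) (r : ℚ) :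
    (∑ j : Fin q, (fun x ↦ c * (fun x ↦ ∑ k ∈ Fintype.piFinset (fun _ : S₀ ↦ Finset.range 3), (∏ v : S₀, ((W.localPolynomialAt (v : IsDedekindDomain.HeightOneSpectrum (NumberField.RingOfIntegers ℚ))).map (Int.castRingHom (PadicAlgCl 2))).coeff (k v) * ((Rat.HeightOneSpectrum.natGenerator (v : IsDedekindDomain.HeightOneSpectrum (NumberField.RingOfIntegers ℚ)) : PadicAlgCl 2)⁻¹) ^ (k v)) * algebraMap ℚ (PadicAlgCl 2) (ratPlusSymbol f (x * ((∏ v : S₀, Rat.HeightOneSpectrum.natGenerator (v : IsDedekindDomain.HeightOneSpectrum (NumberField.RingOfIntegers ℚ)) ^ (k v) : ℕ) : ℚ)))) x) ((r + j) / q)) +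
        (fun x ↦ c * (fun x ↦ ∑ k ∈ Fintype.piFinset (fun _ : S₀ ↦ Finset.range 3), (∏ v : S₀, ((W.localPolynomialAt (v : IsDedekindDomain.HeightOneSpectrum (NumberField.RingOfIntegers ℚ))).map (Int.castRingHom (PadicAlgCl 2))).coeff (k v) * ((Rat.HeightOneSpectrum.natGenerator (v : IsDedekindDomain.HeightOneSpectrum (NumberField.RingOfIntegers ℚ)) : PadicAlgCl 2)⁻¹) ^ (k v)) * algebraMap ℚ (PadicAlgCl 2) (ratPlusSymbol f (x * ((∏ v : S₀, Rat.HeightOneSpectrum.natGenerator (v : IsDedekindDomain.HeightOneSpectrum (NumberField.RingOfIntegers ℚ)) ^ (k v) : ℕ) : ℚ)))) x) (q * r) -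
      (W.LFunction q : PadicAlgCl 2) * (fun x ↦ c * (fun x ↦ ∑ k ∈ Fintype.piFinset (fun _ : S₀ ↦ Finset.range 3), (∏ v : S₀, ((W.localPolynomialAt (v : IsDedekindDomain.HeightOneSpectrum (NumberField.RingOfIntegers ℚ))).map (Int.castRingHom (PadicAlgCl 2))).coeff (k v) * ((Rat.HeightOneSpectrum.natGenerator (v : IsDedekindDomain.HeightOneSpectrum (NumberField.RingOfIntegers ℚ)) : PadicAlgCl 2)⁻¹) ^ (k v)) * algebraMap ℚ (PadicAlgCl 2) (ratPlusSymbol f (x * ((∏ v : S₀, Rat.HeightOneSpectrum.natGenerator (v : IsDedekindDomain.HeightOneSpectrum (NumberField.RingOfIntegers ℚ)) ^ (k v) : ℕ) : ℚ)))) x) r = 0 := by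
  have hT := heckeT_depletedCurveSymbol_localPolynomialAt hf S₀ hq hqS r
  rw [if_neg hqN, mul_inv_cancel₀ (by exact_mod_cast hq.ne_zero : (q : PadicAlgCl 2) ≠ 0), one_mul] at hT
  simp only
  rw [← Finset.mul_sum, ← mul_add, mul_left_comm, ← mul_sub, hT, sub_self, mul_zero]

/-- **`U_ℓ (c·φ^{S₀}_W) = 0`** for every prime `ℓ` of `N_W·M·∏_v ℓ_v²` (w2's
`heckeU_depletedCurveSymbol_localPolynomialAt_eq_zero` at the place `v₀ ∈ S₀` with `ℓ_{v₀} = ℓ`).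
[cite: GreenbergVatsal2000, §3] -/
theorem depletedCurveSymbol_heckeU_eq_zero (hf : IsNewformOf W f) (c : PadicAlgCl 2) {M : ℕ}
    (hSW : ∀ v : IsDedekindDomain.HeightOneSpectrum (NumberField.RingOfIntegers ℚ), ¬ W.HasGoodReductionAt v → v ∈ S₀)
    (hSM : ∀ v : IsDedekindDomain.HeightOneSpectrum (NumberField.RingOfIntegers ℚ),
      Rat.HeightOneSpectrum.natGenerator v ∣ M → v ∈ S₀)
    {ℓ : ℕ} (hℓ : ℓ.Prime) (hdvd : ℓ ∣ W.conductorNorm ℤ * M * (∏ v : S₀, Rat.HeightOneSpectrum.natGenerator (v : IsDedekindDomain.HeightOneSpectrum (NumberField.RingOfIntegers ℚ)) ^ 2)) (r : ℚ) :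
    ∑ j : Fin ℓ, (fun x ↦ c * (fun x ↦ ∑ k ∈ Fintype.piFinset (fun _ : S₀ ↦ Finset.range 3), (∏ v : S₀, ((W.localPolynomialAt (v : IsDedekindDomain.HeightOneSpectrum (NumberField.RingOfIntegers ℚ))).map (Int.castRingHom (PadicAlgCl 2))).coeff (k v) * ((Rat.HeightOneSpectrum.natGenerator (v : IsDedekindDomain.HeightOneSpectrum (NumberField.RingOfIntegers ℚ)) : PadicAlgCl 2)⁻¹) ^ (k v)) * algebraMap ℚ (PadicAlgCl 2) (ratPlusSymbol f (x * ((∏ v : S₀, Rat.HeightOneSpectrum.natGenerator (v : IsDedekindDomain.HeightOneSpectrum (NumberField.RingOfIntegers ℚ)) ^ (k v) : ℕ) : ℚ)))) x) ((r + j) / ℓ) = 0 := by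
  obtain ⟨v₀, hv₀, hgen⟩ := exists_mem_natGenerator_eq_of_dvd W S₀ hSW hSM hℓ hdvd
  subst hgen
  simp only
  rw [← Finset.mul_sum, heckeU_depletedCurveSymbol_localPolynomialAt_eq_zero hf S₀ hv₀ r, mul_zero]

end Curve

/-! ## §3. The research stub (H-sym-min) FROM the plus-line stub (C3) -/

section Glue

/-- **(H-sym-min) `stub_depletedSymbolCongruenceTwo` (skeleton v5/v6 of line `birth`) FROM THE PLUS-LINE STUB (C3).**
(C3) `PlusLine`: for `W` good supersingular at `2` with `Δ_W < 0`, an odd `N'` divisible by the primes of `N_W`, and two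
functions `Φ₁, Φ₂ : ℚ → ℚ̄₂` that are `1`-periodic, even, Γ₀(N')-modular-symbol functions (Manin), integral, primitive,
`T_q`-eigen mod `𝔪` with eigenvalues `a_q(W) = W.LFunction q` (`q ∤ N'`) and `U_ℓ`-killed mod `𝔪` (`ℓ ∣ N'`), there is
`a` with `‖a·Φ₁ − Φ₂‖ < 1` pointwise («multiplicity one mod `2` on the plus part»; research). PROOF of the glue: fix the
crux's data and a layer `n`; if no layer-`n` depleted partner value is a unit, `a = 0`; otherwise apply (C3) at
`N' = N_W·M·∏_v ℓ_v²` to `Φ₁ := c·φ^{S₀}_W` (`c` the primitive scaling of `…CurveSymbolPrimitive`, w2) and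
`Φ₂ := φ^{S₀}_{g,Ω}`: all hypotheses are §1–§2 (Manin: `…PlusManin`; Hecke: w2's `…DepletedHecke`, `…CurveEulerHecke`,
`…EigencharacterCongruence`). The minimality clause of (H-sym-min) is not even used, and `n₀ = 0`.
[cite: GreenbergVatsal2000, §1 (10) and §3; Vatsal1999, Thm. (1.10)] -/
theorem stub_depletedSymbolCongruenceTwo_of_plusLine
    (hC3 : ∀ (W : WeierstrassCurve ℚ) [W.IsElliptic] [W.IsGloballyMinimal], Literature.NumberTheory.EllipticCurves.Rank1Residual.GoodSS W 2 → W.Δ < 0 → ∀ (N' : ℕ), Odd N' → (∀ ℓ : ℕ, ℓ.Prime → ℓ ∣ W.conductorNorm ℤ → ℓ ∣ N') → ∀ (Φ₁ Φ₂ : ℚ → PadicAlgCl 2), (∀ (r : ℚ) (z : ℤ), Φ₁ (r + z) = Φ₁ r) → (∀ r : ℚ, Φ₁ (-r) = Φ₁ r) → (∀ (γ : CongruenceSubgroup.Gamma0 (N')) (r : ℚ), ((γ : SL(2, ℤ)) 1 0 : ℚ) * r + ((γ : SL(2, ℤ)) 1 1 : ℚ) ≠ 0 → Φ₁ ((((γ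 : SL(2, ℤ)) 0 0 : ℚ) * r + ((γ : SL(2, ℤ)) 0 1 : ℚ)) / (((γ : SL(2, ℤ)) 1 0 : ℚ) * r + ((γ : SL(2, ℤ)) 1 1 : ℚ))) = (if ((γ : SL(2, ℤ)) 1 0) = 0 then 0 else Φ₁ ((((γ : SL(2, ℤ)) 0 0 : ℚ)) / (((γ : SL(2, ℤ)) 1 0 : ℚ)))) + Φ₁ r) → (∀ (r : ℚ) (z : ℤ), Φ₂ (r + z) = Φ₂ r) → (∀ r : ℚ, Φ₂ (-r) = Φ₂ r) → (∀ (γ : CongruenceSubgroup.Gamma0 (N')) (r : ℚ), ((γ : SL(2, ℤ)) 1 0 : ℚ) * r + ((γ : SL(2, ℤ)) 1 1 : ℚ) ≠ 0 → Φ₂ ((((γ : SL(2, ℤ)) 0 0 : ℚ) * r + ((γ : SL(2, ℤ)) 0 1 : ℚ)) / (((γ : SL(2, ℤ)) 1 0 : ℚ) * r + ((γ : SL(2, ℤ)) 1 1 : ℚ))) = (if ((γ : SL(2, ℤ)) 1 0) = 0 then 0 else Φ₂ ((((γ : SL(2, ℤ)) 0 0 : ℚ)) / (((γ : SL(2, ℤ))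 1 0 : ℚ)))) + Φ₂ r) → (∀ r : ℚ, ‖Φ₁ r‖ ≤ 1) → (∀ r : ℚ, ‖Φ₂ r‖ ≤ 1) → (∃ r : ℚ, ‖Φ₁ r‖ = 1) → (∃ r : ℚ, ‖Φ₂ r‖ = 1) → (∀ q : ℕ, q.Prime → ¬ q ∣ N' → ∀ r : ℚ, ‖(∑ j : Fin q, Φ₁ ((r + j) / q)) + Φ₁ (q * r) - (W.LFunction q : PadicAlgCl 2) * Φ₁ r‖ < 1) → (∀ q : ℕ, q.Prime → ¬ q ∣ N' → ∀ r : ℚ, ‖(∑ j : Fin q, Φ₂ ((r + j) / q)) + Φ₂ (q * r) - (W.LFunction q : PadicAlgCl 2) * Φ₂ r‖ < 1) → (∀ ℓ : ℕ, ℓ.Prime → ℓ ∣ N' → ∀ r : ℚ, ‖∑ j : Fin ℓ, Φ₁ ((r + j) / ℓ)‖ < 1) → (∀ ℓ : ℕ, ℓ.Prime → ℓ ∣ N' → ∀ r : ℚ, ‖∑ j : Fin ℓ, Φ₂ ((r + j) / ℓ)‖ < 1) → ∃ a : PadicAlgCl 2, ∀ r : ℚ, ‖a * Φ₁ r - Φ₂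 r‖ < 1) :
    ∀ (W : WeierstrassCurve ℚ) [W.IsElliptic] [W.IsGloballyMinimal], ¬ W.HasCM → W.analyticRank = 0 → Literature.NumberTheory.EllipticCurves.Rank1Residual.GoodSS W 2 → W.frobeniusTrace 2 = 0 → W.Δ < 0 → ∀ (M : ℕ) [NeZero M] (g : CuspForm (CongruenceSubgroup.Gamma0 M) 2) (ι : Literature.NumberTheory.EllipticCurves.ModularForms.coeffField g →+* PadicAlgCl 2) (Ω : ℂ), Odd M → Literature.NumberTheory.EllipticCurves.ModularForms.IsNewform0 g → Literature.NumberTheory.Automorphic.IsCMForm (Literature.NumberTheory.EllipticCurves.ModularForms.liftToGamma1 M 2 g) → Literature.NumberTheory.EllipticCurves.ModularForms.cuspCoeff g 2 = 0 → Literature.NumberTheory.EllipticCurves.IsCohomologicalPlusPeriod g ι Ω → (∀ ℓ : ℕ, ℓ.Prime → ¬ ℓ ∣ 2 * M * W.conductorNorm ℤ → ‖Literature.NumberTheory.EllipticCurves.embCoeff g ι ℓ - (W.frobeniusTrace ℓ : PadicAlgCl 2)‖ < 1) → ∀ [NeZero (W.conductorNorm ℤ)] (f : CuspForm (CongruenceSubgroup.Gamma0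 (W.conductorNorm ℤ)) 2), Literature.NumberTheory.EllipticCurves.ModularForms.IsNewformOf W f → ∀ (S₀ : Finset (IsDedekindDomain.HeightOneSpectrum (NumberField.RingOfIntegers ℚ))), (∀ v ∈ S₀, ((2 : ℕ) : NumberField.RingOfIntegers ℚ) ∉ v.asIdeal) → (∀ v : IsDedekindDomain.HeightOneSpectrum (NumberField.RingOfIntegers ℚ), ¬ W.HasGoodReductionAt v → v ∈ S₀) → (∀ v : IsDedekindDomain.HeightOneSpectrum (NumberField.RingOfIntegers ℚ), Rat.HeightOneSpectrum.natGenerator v ∣ M → v ∈ S₀) → (∀ v ∈ S₀, ¬ W.HasGoodReductionAt v ∨ Rat.HeightOneSpectrum.natGenerator v ∣ M) → ∃ n₀ : ℕ, ∀ n ≥ n₀, Even n → ∃ a : PadicAlgCl 2, ∀ s : ZMod (2 ^ n), ‖a * (∑ k ∈ Fintype.piFinset (fun _ : S₀ ↦ Finset.range 3), (∏ v : S₀, ((W.localPolynomialAt (v : IsDedekindDomain.HeightOneSpectrum (NumberField.RingOfIntegers ℚ))).map (Int.castRingHom (PadicAlgCl 2))).coeff (k v) * ((Rat.HeightOneSpectrum.natGenerator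 (v : IsDedekindDomain.HeightOneSpectrum (NumberField.RingOfIntegers ℚ)) : PadicAlgCl 2)⁻¹) ^ (k v)) * algebraMap ℚ (PadicAlgCl 2) (Literature.NumberTheory.EllipticCurves.ratPlusSymbol f (((((Literature.NumberTheory.EllipticCurves.cyclotomicGenerator 2 : ZMod (2 ^ (n + 2))) ^ s.val).val : ℚ) / (2 : ℚ) ^ (n + 2)) * ((∏ v : S₀, Rat.HeightOneSpectrum.natGenerator (v : IsDedekindDomain.HeightOneSpectrum (NumberField.RingOfIntegers ℚ)) ^ (k v) : ℕ) : ℚ)))) - (∑ k ∈ Fintype.piFinset (fun _ : S₀ ↦ Finset.range 3), (∏ v : S₀, (1 - Polynomial.C (Literature.NumberTheory.EllipticCurves.embCoeff g ι (Rat.HeightOneSpectrum.natGenerator (v : IsDedekindDomain.HeightOneSpectrum (NumberField.RingOfIntegers ℚ)))) * Polynomial.X + (if Rat.HeightOneSpectrum.natGenerator (v : IsDedekindDomain.HeightOneSpectrum (NumberField.RingOfIntegers ℚ)) ∣ M then 0 else Polynomial.C (Rat.HeightOneSpectrum.natGenerator (v : IsDedekindDomain.HeightOneSpectrum (NumberField.RingOfIntegers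 ℚ)) : PadicAlgCl 2)) * Polynomial.X ^ 2 : Polynomial (PadicAlgCl 2)).coeff (k v) * ((Rat.HeightOneSpectrum.natGenerator (v : IsDedekindDomain.HeightOneSpectrum (NumberField.RingOfIntegers ℚ)) : PadicAlgCl 2)⁻¹) ^ (k v)) * ι (Literature.NumberTheory.EllipticCurves.plusSymbolK g Ω (((((Literature.NumberTheory.EllipticCurves.cyclotomicGenerator 2 : ZMod (2 ^ (n + 2))) ^ s.val).val : ℚ) / (2 : ℚ) ^ (n + 2)) * ((∏ v : S₀, Rat.HeightOneSpectrum.natGenerator (v : IsDedekindDomain.HeightOneSpectrum (NumberField.RingOfIntegers ℚ)) ^ (k v) : ℕ) : ℚ))))‖ < 1 := by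
  intro W _ _ hcm hr hss ha hΔ M _ g ι Ω hodd hnew hcmg ha2 hΩ hcong _ f hf S₀ hS2 hSW hSM hmin
  refine ⟨0, fun n _ _ ↦ ?_⟩
  haveI : NeZero (2 ^ n) := ⟨pow_ne_zero _ two_ne_zero⟩
  by_cases hunit : ∃ s : ZMod (2 ^ n), ‖(∑ k ∈ Fintype.piFinset (fun _ : S₀ ↦ Finset.range 3), (∏ v : S₀, (1 - Polynomial.C (embCoeff g ι (Rat.HeightOneSpectrum.natGenerator (v : IsDedekindDomain.HeightOneSpectrum (NumberField.RingOfIntegers ℚ)))) * Polynomial.X + (if Rat.HeightOneSpectrum.natGenerator (v : IsDedekindDomain.HeightOneSpectrum (NumberField.RingOfIntegers ℚ)) ∣ M then 0 else Polynomial.C (Rat.HeightOneSpectrum.natGenerator (v : IsDedekindDomain.HeightOneSpectrum (NumberField.RingOfIntegers ℚ)) : PadicAlgCl 2)) * Polynomial.X ^ 2 : Polynomial (PadicAlgCl 2)).coeff (k v) * ((Rat.HeightOneSpectrum.natGenerator (v : IsDedekindDomain.HeightOneSpectrum (NumberField.RingOfIntegers ℚ)) : PadicAlgCl 2)⁻¹)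 ^ (k v)) * ι (plusSymbolK g Ω ((((((cyclotomicGenerator 2 : ZMod (2 ^ (n + 2))) ^ s.val).val : ℚ) / (2 : ℚ) ^ (n + 2))) * ((∏ v : S₀, Rat.HeightOneSpectrum.natGenerator (v : IsDedekindDomain.HeightOneSpectrum (NumberField.RingOfIntegers ℚ)) ^ (k v) : ℕ) : ℚ))))‖ = 1
  · obtain ⟨s₀, hs₀⟩ := hunit
    obtain ⟨c, hcint, hcprim⟩ := exists_primitive_scaling_depletedCurveSymbol hf hr S₀ hS2
    have hN'odd := odd_depletedLevel W hss hodd S₀ hS2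
    have hN'W : ∀ ℓ : ℕ, ℓ.Prime → ℓ ∣ W.conductorNorm ℤ →
        ℓ ∣ W.conductorNorm ℤ * M * (∏ v : S₀, Rat.HeightOneSpectrum.natGenerator (v : IsDedekindDomain.HeightOneSpectrum (NumberField.RingOfIntegers ℚ)) ^ 2) :=
      fun ℓ _ h ↦ dvd_mul_of_dvd_left (dvd_mul_of_dvd_left h M) _
    have hdvdW : W.conductorNorm ℤ * (∏ v : S₀, Rat.HeightOneSpectrum.natGenerator (v : IsDedekindDomain.HeightOneSpectrum (NumberField.RingOfIntegers ℚ)) ^ 2) ∣ W.conductorNorm ℤ * M * (∏ v : S₀, Rat.HeightOneSpectrum.natGenerator (v : IsDedekindDomain.HeightOneSpectrum (NumberField.RingOfIntegers ℚ)) ^ 2) :=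
      ⟨M, by ring⟩
    have hdvdM : M * (∏ v : S₀, Rat.HeightOneSpectrum.natGenerator (v : IsDedekindDomain.HeightOneSpectrum (NumberField.RingOfIntegers ℚ)) ^ 2) ∣ W.conductorNorm ℤ * M * (∏ v : S₀, Rat.HeightOneSpectrum.natGenerator (v : IsDedekindDomain.HeightOneSpectrum (NumberField.RingOfIntegers ℚ)) ^ 2) :=
      ⟨W.conductorNorm ℤ, by ring⟩
    -- primes off the depleted level
    have hoff : ∀ q : ℕ, ¬ q ∣ W.conductorNorm ℤ * M * (∏ v : S₀, Rat.HeightOneSpectrum.natGenerator (v : IsDedekindDomain.HeightOneSpectrum (NumberField.RingOfIntegers ℚ)) ^ 2) →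
        ¬ q ∣ W.conductorNorm ℤ ∧ ¬ q ∣ M ∧ ∀ v ∈ S₀, Rat.HeightOneSpectrum.natGenerator v ≠ q :=
      fun q hnd ↦ off_depletedLevel W M S₀ hnd
    obtain ⟨a, ha'⟩ := hC3 W hss hΔ _ hN'odd hN'W
      (fun x ↦ c * (fun x ↦ ∑ k ∈ Fintype.piFinset (fun _ : S₀ ↦ Finset.range 3), (∏ v : S₀, ((W.localPolynomialAt (v : IsDedekindDomain.HeightOneSpectrum (NumberField.RingOfIntegers ℚ))).map (Int.castRingHom (PadicAlgCl 2))).coeff (k v) * ((Rat.HeightOneSpectrum.natGenerator (v : IsDedekindDomain.HeightOneSpectrum (NumberField.RingOfIntegers ℚ)) : PadicAlgCl 2)⁻¹) ^ (k v)) * algebraMap ℚ (PadicAlgCl 2) (ratPlusSymbol f (x * ((∏ v : S₀, Rat.HeightOneSpectrum.natGenerator (v : IsDedekindDomain.HeightOneSpectrum (NumberField.RingOfIntegers ℚ)) ^ (k v) : ℕ) : ℚ)))) x) (fun x ↦ ∑ k ∈ Fintype.piFinset (fun _ : S₀ ↦ Finset.range 3), (∏ v : S₀, (1 - Polynomial.C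 (embCoeff g ι (Rat.HeightOneSpectrum.natGenerator (v : IsDedekindDomain.HeightOneSpectrum (NumberField.RingOfIntegers ℚ)))) * Polynomial.X + (if Rat.HeightOneSpectrum.natGenerator (v : IsDedekindDomain.HeightOneSpectrum (NumberField.RingOfIntegers ℚ)) ∣ M then 0 else Polynomial.C (Rat.HeightOneSpectrum.natGenerator (v : IsDedekindDomain.HeightOneSpectrum (NumberField.RingOfIntegers ℚ)) : PadicAlgCl 2)) * Polynomial.X ^ 2 : Polynomial (PadicAlgCl 2)).coeff (k v) * ((Rat.HeightOneSpectrum.natGenerator (v : IsDedekindDomain.HeightOneSpectrum (NumberField.RingOfIntegers ℚ)) : PadicAlgCl 2)⁻¹) ^ (k v)) * ι (plusSymbolK g Ω (x * ((∏ v : S₀, Rat.HeightOneSpectrum.natGenerator (v : IsDedekindDomain.HeightOneSpectrum (NumberField.RingOfIntegers ℚ)) ^ (k v) : ℕ) : ℚ))))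
      (depletedCurveSymbol_add_intCast W S₀ c) (depletedCurveSymbol_neg W S₀ c)
      (depletedCurveSymbol_gamma0_smul_of_dvd hf c hdvdW)
      (depletedPartnerSymbol_add_intCast g ι Ω S₀) (depletedPartnerSymbol_neg g ι Ω S₀)
      (depletedPartnerSymbol_gamma0_smul_of_dvd g ι Ω S₀ hΩ.isPlusPeriod hdvdM)
      hcint (norm_depletedPartnerSymbol_le_one' g ι Ω S₀ hnew hΩ hS2) hcprim ⟨_, hs₀⟩
      (fun q hq hnd r ↦ by
        rw [depletedCurveSymbol_heckeT_sub_eq_zero hf c hq (hoff q hnd).1 (hoff q hnd).2.2 r, norm_zero]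
        exact zero_lt_one)
      (fun q hq hnd r ↦ depletedPartnerSymbol_heckeT_sub_lt_one g ι Ω S₀ hnew hΩ hS2 W ha2 ha hcong hSW hSM hq
        (hoff q hnd).2.1 (hoff q hnd).2.2 r)
      (fun ℓ hℓ hd r ↦ by
        rw [depletedCurveSymbol_heckeU_eq_zero hf c hSW hSM hℓ hd r, norm_zero]; exact zero_lt_one)
      (fun ℓ hℓ hd r ↦ by
        rw [depletedPartnerSymbol_heckeU_eq_zero g ι Ω S₀ hnew hΩ.isPlusPeriod W hSW hSM hℓ hd r, norm_zero]
        exact zero_lt_one)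
    refine ⟨a * c, fun s ↦ ?_⟩
    have h := ha' (((((cyclotomicGenerator 2 : ZMod (2 ^ (n + 2))) ^ s.val).val : ℚ) / (2 : ℚ) ^ (n + 2)))
    simp only at h
    rwa [← mul_assoc] at h
  · push Not at hunit
    refine ⟨0, fun s ↦ ?_⟩
    rw [zero_mul, zero_sub, norm_neg]
    exact lt_of_le_of_ne (norm_depletedPartnerSymbol_le_one' g ι Ω S₀ hnew hΩ hS2 _) (hunit s)

/-- **THE CRUX `ThetaLayerLambdaCongruenceAtTwo` BY NAME from (C3) + (μ-sym₁)** — the composition of skeleton v7 of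
line `birth`: the plus-line stub (multiplicity one mod `2` for depleted plus-symbol functions; research, inputs in
print) and ONE unit value of the partner's depleted plus symbol at ONE even layer (conjecture-grade `μ = 0`; a finite
check per instance). Everything else — depletion identity, `Δ`-doubling, isometry, layer-`λ` stability, change of
period, `S₀`-monotonicity, depleted growth along the tower, Manin relations, full-Hecke eigen-ness of both depleted
symbols, the eigencharacter congruence, the primitive scaling of the curve side, (coh) — is LANDED.
[cite: GreenbergVatsal2000, §1 (10) and Thm. (1.4) (shape; the two inputs are hypotheses)] -/
theorem thetaLayerLambdaCongruenceAtTwo_of_plusLine_oneLayer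
    (hC3 : ∀ (W : WeierstrassCurve ℚ) [W.IsElliptic] [W.IsGloballyMinimal], Literature.NumberTheory.EllipticCurves.Rank1Residual.GoodSS W 2 → W.Δ < 0 → ∀ (N' : ℕ), Odd N' → (∀ ℓ : ℕ, ℓ.Prime → ℓ ∣ W.conductorNorm ℤ → ℓ ∣ N') → ∀ (Φ₁ Φ₂ : ℚ → PadicAlgCl 2), (∀ (r : ℚ) (z : ℤ), Φ₁ (r + z) = Φ₁ r) → (∀ r : ℚ, Φ₁ (-r) = Φ₁ r) → (∀ (γ : CongruenceSubgroup.Gamma0 (N')) (r : ℚ), ((γ : SL(2, ℤ)) 1 0 : ℚ) * r + ((γ : SL(2, ℤ)) 1 1 : ℚ) ≠ 0 → Φ₁ ((((γ : SL(2, ℤ)) 0 0 : ℚ) * r + ((γ : SL(2, ℤ)) 0 1 : ℚ)) / (((γ : SL(2, ℤ)) 1 0 : ℚ) * r + ((γ : SL(2, ℤ)) 1 1 : ℚ))) = (if ((γ : SL(2, ℤ)) 1 0) = 0 then 0 else Φ₁ ((((γ : SL(2, ℤ)) 0 0 : ℚ)) / (((γ : SL(2, ℤ)) 1 0 : ℚ))))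 + Φ₁ r) → (∀ (r : ℚ) (z : ℤ), Φ₂ (r + z) = Φ₂ r) → (∀ r : ℚ, Φ₂ (-r) = Φ₂ r) → (∀ (γ : CongruenceSubgroup.Gamma0 (N')) (r : ℚ), ((γ : SL(2, ℤ)) 1 0 : ℚ) * r + ((γ : SL(2, ℤ)) 1 1 : ℚ) ≠ 0 → Φ₂ ((((γ : SL(2, ℤ)) 0 0 : ℚ) * r + ((γ : SL(2, ℤ)) 0 1 : ℚ)) / (((γ : SL(2, ℤ)) 1 0 : ℚ) * r + ((γ : SL(2, ℤ)) 1 1 : ℚ))) = (if ((γ : SL(2, ℤ)) 1 0) = 0 then 0 else Φ₂ ((((γ : SL(2, ℤ)) 0 0 : ℚ)) / (((γ : SL(2, ℤ)) 1 0 : ℚ)))) + Φ₂ r) → (∀ r : ℚ, ‖Φ₁ r‖ ≤ 1) → (∀ r : ℚ, ‖Φ₂ r‖ ≤ 1) → (∃ r : ℚ, ‖Φ₁ r‖ = 1) → (∃ r : ℚ, ‖Φ₂ r‖ = 1) → (∀ q : ℕ, q.Prime → ¬ q ∣ N' → ∀ r : ℚ, ‖(∑ j : Fin q, Φ₁ ((r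 + j) / q)) + Φ₁ (q * r) - (W.LFunction q : PadicAlgCl 2) * Φ₁ r‖ < 1) → (∀ q : ℕ, q.Prime → ¬ q ∣ N' → ∀ r : ℚ, ‖(∑ j : Fin q, Φ₂ ((r + j) / q)) + Φ₂ (q * r) - (W.LFunction q : PadicAlgCl 2) * Φ₂ r‖ < 1) → (∀ ℓ : ℕ, ℓ.Prime → ℓ ∣ N' → ∀ r : ℚ, ‖∑ j : Fin ℓ, Φ₁ ((r + j) / ℓ)‖ < 1) → (∀ ℓ : ℕ, ℓ.Prime → ℓ ∣ N' → ∀ r : ℚ, ‖∑ j : Fin ℓ, Φ₂ ((r + j) / ℓ)‖ < 1) → ∃ a : PadicAlgCl 2, ∀ r : ℚ, ‖a * Φ₁ r - Φ₂ r‖ < 1)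
    (hμ : ∀ (W : WeierstrassCurve ℚ) [W.IsElliptic] [W.IsGloballyMinimal], ¬ W.HasCM → W.analyticRank = 0 → Literature.NumberTheory.EllipticCurves.Rank1Residual.GoodSS W 2 → W.frobeniusTrace 2 = 0 → W.Δ < 0 → ∀ (M : ℕ) [NeZero M] (g : CuspForm (CongruenceSubgroup.Gamma0 M) 2) (ι : Literature.NumberTheory.EllipticCurves.ModularForms.coeffField g →+* PadicAlgCl 2) (Ω : ℂ), Odd M → Literature.NumberTheory.EllipticCurves.ModularForms.IsNewform0 g → Literature.NumberTheory.Automorphic.IsCMForm (Literature.NumberTheory.EllipticCurves.ModularForms.liftToGamma1 M 2 g) → Literature.NumberTheory.EllipticCurves.ModularForms.cuspCoeff g 2 = 0 → Literature.NumberTheory.EllipticCurves.IsCohomologicalPlusPeriod g ι Ω → (∀ ℓ : ℕ, ℓ.Prime → ¬ ℓ ∣ 2 * M * W.conductorNorm ℤ → ‖Literature.NumberTheory.EllipticCurves.embCoeff g ι ℓ - (W.frobeniusTrace ℓ : PadicAlgCl 2)‖ < 1) → ∀ [NeZero (W.conductorNorm ℤ)] (f : CuspForm (CongruenceSubgroup.Gamma0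 (W.conductorNorm ℤ)) 2), Literature.NumberTheory.EllipticCurves.ModularForms.IsNewformOf W f → ∀ (S₀ : Finset (IsDedekindDomain.HeightOneSpectrum (NumberField.RingOfIntegers ℚ))), (∀ v ∈ S₀, ((2 : ℕ) : NumberField.RingOfIntegers ℚ) ∉ v.asIdeal) → (∀ v : IsDedekindDomain.HeightOneSpectrum (NumberField.RingOfIntegers ℚ), ¬ W.HasGoodReductionAt v → v ∈ S₀) → (∀ v : IsDedekindDomain.HeightOneSpectrum (NumberField.RingOfIntegers ℚ), Rat.HeightOneSpectrum.natGenerator v ∣ M → v ∈ S₀) → ∃ n₁ : ℕ, Even n₁ ∧ ∃ s : ZMod (2 ^ n₁), ‖(∑ k ∈ Fintype.piFinset (fun _ : S₀ ↦ Finset.range 3), (∏ v : S₀, (1 - Polynomial.C (Literature.NumberTheory.EllipticCurves.embCoeff g ι (Rat.HeightOneSpectrum.natGenerator (v : IsDedekindDomain.HeightOneSpectrum (NumberField.RingOfIntegers ℚ)))) * Polynomial.X + (if Rat.HeightOneSpectrum.natGenerator (v : IsDedekindDomain.HeightOneSpectrum (NumberField.RingOfIntegers ℚ)) ∣ M then 0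 else Polynomial.C (Rat.HeightOneSpectrum.natGenerator (v : IsDedekindDomain.HeightOneSpectrum (NumberField.RingOfIntegers ℚ)) : PadicAlgCl 2)) * Polynomial.X ^ 2 : Polynomial (PadicAlgCl 2)).coeff (k v) * ((Rat.HeightOneSpectrum.natGenerator (v : IsDedekindDomain.HeightOneSpectrum (NumberField.RingOfIntegers ℚ)) : PadicAlgCl 2)⁻¹) ^ (k v)) * ι (Literature.NumberTheory.EllipticCurves.plusSymbolK g Ω (((((Literature.NumberTheory.EllipticCurves.cyclotomicGenerator 2 : ZMod (2 ^ (n₁ + 2))) ^ s.val).val : ℚ) / (2 : ℚ) ^ (n₁ + 2)) * ((∏ v : S₀, Rat.HeightOneSpectrum.natGenerator (v : IsDedekindDomain.HeightOneSpectrum (NumberField.RingOfIntegers ℚ)) ^ (k v) : ℕ) : ℚ))))‖ = 1) :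
    Summit.BirchSwinnertonDyer.BirchSwinnertonDyer.Theses.ResidualThetaTransportAtTwo.ThetaLayerLambdaCongruenceAtTwo :=
  thetaLayerLambdaCongruenceAtTwo_of_symbolStubs_oneLayer (stub_depletedSymbolCongruenceTwo_of_plusLine hC3) hμ

end Glue

end Summit.BirchSwinnertonDyer.BirchSwinnertonDyer.Theorems.ThetaLayerLambdaCongruenceAtTwo

end
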